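import Literature.NumberTheory.IwasawaTheory.ClassicalMuVanishesUnramifiedClassesTower
import Literature.NumberTheory.IwasawaTheory.ClassicalMuVanishesUnramifiedClasses
import Literature.NumberTheory.EllipticCurves.GreenbergSelmerDualDataExistsProofs
import Literature.NumberTheory.EllipticCurves.FineSelmerRestrictionDescentProofs
import HarnessLib

/-!
# Iwasawa's `μ = 0` in character form, II: the locally nilpotent operator `conj_γ − 1` and the DISCHARGE of
# `IwasawaTheory.classicalMuVanishes_finite_unramifiedClasses` (proved; no definition, no named fact)

`Proofs`-style file in topic `NumberTheory/IwasawaTheory` (namespace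
`Literature.NumberTheory.IwasawaTheory.ClassicalMuVanishesUnramifiedClasses`), written by the prover seat
`bsd-potss-rkm` g34 (cell `bsd-potss`, item stmt-BirchSwinnertonDyer-19196; closes nothing).  Second half of the
discharge of the named fact `classicalMuVanishes_finite_unramifiedClasses` (file
`ClassicalMuVanishesUnramifiedClasses.lean`, typed by cell `bsd-2adic`): **growth-form `μ = 0`
(`ClassicalMuVanishes κ`: `ord_p #Cl(K_n) = λ n + ν` for `n ≫ 0`) implies that the classes of `H¹(Gal(K̄/K_∞), M)`
all of whose conjugates are unramified at every finite place form a FINITE set**, for every finite `p`-primary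
trivial `Γ_K`-module `M` (`p` odd or `K` totally complex) — `classicalMuVanishes_finite_unramifiedClasses_holds`.

The textbook road (Lang Ch. 5 / Washington §13.3: `X_nr ≅ lim← A_n` by class field theory, structure theory of
finitely generated `Λ`-modules, `μ = 0 ⟺ X/pX` finite) is replaced by an elementary one that never builds `X_nr`:

* UPPER BOUND (part I, `…Tower.lean`): for `n ≥ n₀` every finite set of everywhere-unramified classes fixed by
  `conj_{γ^{pⁿ}}` has `≤ #M ^ e_{n+k}` elements (`p^k M = 0`), by Greenberg's Lemma 3.2 and the sharp
  finite-level class-field-theoretic count.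
* LOWER BOUND (§2–§3 here): on the `p`-TORSION classes `V`, `T = conj_γ − 1` satisfies
  `T^{pⁿ} = conj_{γ^{pⁿ}} − 1` (Frobenius in `ℤ[X] → 𝔽_p[X]`: `(X−1)^{pⁿ} ≡ X^{pⁿ} − 1 (mod p)`, §1), every class
  is killed by some `T^{pⁿ}` (continuity of the `Γ`-action, tree `exists_conjH1_pow_prime_pow_eq`), and the
  kernels `K_j = V ∩ ker T^j` increase STRICTLY as long as `V` is not exhausted (`K_j = K_{j+1} ⟹ K_{j+1} = K_{j+2}`);
  so if `V` were infinite, `#K_j ≥ 2^j` for every `j` (§2 `two_pow_le_card`), i.e. `2^{pⁿ} ≤ #M ^ e_{n+k}`.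
* GROWTH (§4): with `e_m = λ m + ν` this reads `2^{pⁿ} ≤ p^{k(λ(n+k)+ν)}`, absurd for large `n`; hence `V` is
  finite, and an abelian group of exponent `p^k` with finite `p`-torsion is finite (§2 `finite_of_nsmul_finite`).

Consequences (separate files): Coates–Sujatha 2005 Thm. 3.4 and Lim 2017 Thm. 3.5 (the cell's `hCS`, `hLim`) become
tree theorems via `FineSelmerFiniteOfUnramifiedClasses.thm34_of_…` and `FineSelmerPExtensionDescent.thm35_of_…`.

References: [Lang1990] Ch. 5 §1 Thm. 1.2, §4 pp. 137–143; [Washington1997] §13.3 (Lemma 13.15–13.18, Prop. 13.23);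
[Greenberg2001IwasawaPastPresent] pp. 335–338; [GreenbergLNM1716] §1 («every element is killed by `Tⁿ`»), §3 Lemma 3.2;
[RaySujatha2021] §1 (1.1); [SerreGaloisCohomology1997] I §2.3.
-/

set_option autoImplicit false

noncomputable section

open scoped Classical Pointwise NumberField Polynomial
open NumberField IsDedekindDomain Field IntermediateField

namespace Literature.NumberTheory.IwasawaTheory.ClassicalMuVanishesUnramifiedClasses

open Literature.NumberTheory.EllipticCurves Literature.NumberTheory.EllipticCurves.GreenbergSelmer
  Literature.NumberTheory.EllipticCurves.GreenbergVatsal2000 Literature.NumberTheory.GaloisRepresentations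
  Literature.NumberTheory.NumberFields

/-! ## §1 Algebra: `(φ − 1)^{pⁿ} = φ^{pⁿ} − 1` on `p`-torsion elements -/

/-- **Frobenius on `p`-torsion.** For an endomorphism `φ` of an abelian group and `c` with `p c = 0`:
`((φ − 1)^{pⁿ}) c = (φ^{pⁿ}) c − c`.  In `ℤ[X]` the polynomial `(X − 1)^{pⁿ} − X^{pⁿ} + 1` reduces to `0` in
`𝔽_p[X]` (`(X − 1)^{pⁿ} = X^{pⁿ} − 1` in characteristic `p`), hence equals `p · Q`; evaluate at `φ` and apply to `c`.
[cite: Washington1997, §13.2 (Λ ≅ ℤ_p[[T]], T = γ − 1; ω_n = (1+T)^{pⁿ} − 1)] [folklore] -/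
theorem sub_one_pow_prime_pow_apply_of_torsion {A : Type*} [AddCommGroup A] (p : ℕ) [hp : Fact p.Prime]
    (φ : AddMonoid.End A) (n : ℕ) {c : A} (hc : (p : ℤ) • c = 0) :
    ((φ - 1) ^ p ^ n) c = (φ ^ p ^ n) c - c := by
  set P : ℤ[X] := (Polynomial.X - 1) ^ p ^ n - Polynomial.X ^ p ^ n + 1 with hP
  -- `P ≡ 0 (mod p)`
  have hmap : P.map (Int.castRingHom (ZMod p)) = 0 := by
    rw [hP, Polynomial.map_add, Polynomial.map_sub, Polynomial.map_pow, Polynomial.map_pow,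
      Polynomial.map_sub, Polynomial.map_X, Polynomial.map_one, sub_pow_char_pow, one_pow,
      sub_sub_cancel_left, neg_add_cancel]
  have hcoeff : ∀ i, (p : ℤ) ∣ P.coeff i := fun i => by
    have h := congrArg (fun R : (ZMod p)[X] => R.coeff i) hmap
    simp only [Polynomial.coeff_map, Polynomial.coeff_zero, eq_intCast] at h
    exact (ZMod.intCast_zmod_eq_zero_iff_dvd _ _).1 h
  obtain ⟨Q, hQ⟩ := (Polynomial.C_dvd_iff_dvd_coeff (p : ℤ) P).2 hcoeff
  -- evaluate at `φ` in the ring `AddMonoid.End A`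
  have heval : Polynomial.aeval φ P = (φ - 1) ^ p ^ n - φ ^ p ^ n + 1 := by
    rw [hP, map_add, map_sub, map_pow, map_pow, map_sub, Polynomial.aeval_X, map_one]
  have heval' : Polynomial.aeval φ P = ((p : ℤ) : AddMonoid.End A) * Polynomial.aeval φ Q := by
    rw [hQ, map_mul, Polynomial.aeval_C, algebraMap_int_eq, eq_intCast]
  have happ : ((φ - 1) ^ p ^ n - φ ^ p ^ n + 1) c = 0 := by
    rw [← heval, heval', AddMonoid.End.coe_mul, Function.comp_apply, AddMonoid.End.intCast_apply,
      ← map_zsmul, hc, map_zero]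
  have hexp : ((φ - 1) ^ p ^ n - φ ^ p ^ n + 1) c = ((φ - 1) ^ p ^ n) c - (φ ^ p ^ n) c + c := rfl
  rw [hexp] at happ
  rw [← sub_eq_zero, ← happ]
  abel

/-! ## §2 Group theory: strictly increasing kernel chains, and finiteness from the `p`-torsion -/

/-- **Kernel chains.** Let `K₀ ≤ K₁ ≤ ⋯` be finite subgroups of an abelian group such that `K_j = K_{j+1}` forces
`K_{j+1} = K_{j+2}`, and let `V` be an INFINITE set every element of which lies in some `K_j`.  Then
`2^j ≤ #K_j` for every `j`: the chain never stabilises (else `V ⊆ K_j`), and a proper subgroup has index `≥ 2`.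
(The shape of «`X/pX` infinite ⟹ `rank_p` of the layers unbounded», with `K_j = ker T^j`.)
[cite: Washington1997, §13.3 (proof of Thm. 13.13)] [folklore] -/
theorem two_pow_le_card_of_chain {A : Type*} [AddCommGroup A] (Kc : ℕ → AddSubgroup A)
    (hmono : ∀ j, Kc j ≤ Kc (j + 1)) (hstab : ∀ j, Kc j = Kc (j + 1) → Kc (j + 1) = Kc (j + 2))
    (hfin : ∀ j, (Kc j : Set A).Finite) {V : Set A} (hV : V.Infinite) (hexh : ∀ a ∈ V, ∃ j, a ∈ Kc j)
    (j : ℕ) : 2 ^ j ≤ Nat.card (Kc j) := by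
  have hmono' : Monotone Kc := monotone_nat_of_le_succ hmono
  -- the chain never stabilises
  have hne : ∀ j, Kc j ≠ Kc (j + 1) := by
    intro j heq
    have hall : ∀ t, Kc (j + t) = Kc (j + t + 1) := by
      intro t
      induction t with
      | zero => simpa using heq
      | succ t ih =>
        have := hstab (j + t) ih
        simpa [Nat.add_assoc] using this
    have hconst : ∀ t, Kc (j + t) = Kc j := by
      intro t
      induction t with
      | zero => rfl
      | succ t ih => rw [← Nat.add_assoc, ← hall t, ih]
    apply hV
    refine (hfin j).subset fun a ha => ?_
    obtain ⟨i, hi⟩ := hexh a ha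
    by_cases hij : i ≤ j
    · exact hmono' hij hi
    · obtain ⟨t, rfl⟩ := Nat.exists_eq_add_of_le (Nat.le_of_not_ge hij)
      rw [SetLike.mem_coe, ← hconst t]; exact hi
  -- doubling
  induction j with
  | zero =>
    haveI : Finite (Kc 0) := (hfin 0).to_subtype
    rw [pow_zero]
    exact Nat.card_pos
  | succ j ih =>
    haveI : Finite (Kc (j + 1)) := (hfin (j + 1)).to_subtype
    set L : AddSubgroup (Kc (j + 1)) := (Kc j).addSubgroupOf (Kc (j + 1)) with hL
    have hcard : Nat.card L * L.index = Nat.card (Kc (j + 1)) := AddSubgroup.card_mul_index L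
    have hcardL : Nat.card L = Nat.card (Kc j) :=
      Nat.card_congr (AddSubgroup.addSubgroupOfEquivOfLe (hmono j)).toEquiv
    have hidx1 : L.index ≠ 1 := by
      rw [Ne, AddSubgroup.index_eq_one, hL, AddSubgroup.addSubgroupOf_eq_top]
      intro hle
      exact hne j (le_antisymm (hmono j) hle)
    have hidx0 : L.index ≠ 0 := AddSubgroup.index_ne_zero_of_finite
    have hidx2 : 2 ≤ L.index := by omega
    calc 2 ^ (j + 1) = 2 ^ j * 2 := pow_succ 2 j
      _ ≤ Nat.card (Kc j) * L.index := Nat.mul_le_mul ih hidx2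
      _ = Nat.card (Kc (j + 1)) := by rw [← hcardL, hcard]

/-- **An abelian group of exponent `p^k` whose `p`-torsion inside a subgroup `S` is finite has `S` finite**
(filtration by `S[p^j]`: multiplication by `p` maps `S[p^{j+1}]` to `S[p^j]` with fibres translates of `S[p]`; private helper). [folklore] -/
private theorem finite_of_nsmul_finite {A : Type*} [AddCommGroup A] (S : AddSubgroup A) (p : ℕ) {k : ℕ}
    (hk : ∀ a ∈ S, p ^ k • a = 0) (hfin : {a : A | a ∈ S ∧ p • a = 0}.Finite) : (S : Set A).Finite := by
  have step : ∀ j : ℕ, {a : A | a ∈ S ∧ p ^ j • a = 0}.Finite := by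
    intro j
    induction j with
    | zero =>
      refine (Set.finite_singleton (0 : A)).subset fun a ha => ?_
      rw [Set.mem_setOf_eq, pow_zero, one_smul] at ha
      exact ha.2
    | succ j ih =>
      -- cover by the fibres of `a ↦ p • a` over the finite set of level `j`
      have hcover : {a : A | a ∈ S ∧ p ^ (j + 1) • a = 0} ⊆
          ⋃ b ∈ {a : A | a ∈ S ∧ p ^ j • a = 0}, {a : A | a ∈ S ∧ p ^ (j + 1) • a = 0 ∧ p • a = b} := by
        intro a ha
        refine Set.mem_biUnion (x := p • a) ⟨S.nsmul_mem ha.1 p, ?_⟩ ⟨ha.1, ha.2, rfl⟩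
        rw [← mul_smul, ← pow_succ]; exact ha.2
      refine (ih.biUnion fun b _ => ?_).subset hcover
      by_cases hne : ∃ a₀ : A, a₀ ∈ S ∧ p ^ (j + 1) • a₀ = 0 ∧ p • a₀ = b
      · obtain ⟨a₀, ha₀S, -, ha₀b⟩ := hne
        refine (hfin.image fun t => a₀ + t).subset fun a ha => ?_
        refine ⟨a - a₀, ⟨S.sub_mem ha.1 ha₀S, ?_⟩, add_sub_cancel a₀ a⟩
        rw [smul_sub, ha.2.2, ha₀b, sub_self]
      · have : {a : A | a ∈ S ∧ p ^ (j + 1) • a = 0 ∧ p • a = b} = ∅ :=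
          Set.eq_empty_of_forall_notMem fun a ha => hne ⟨a, ha⟩
        rw [this]; exact Set.finite_empty
  exact (step k).subset fun a ha => ⟨ha, hk a ha⟩

/-- Arithmetic: a linear function is eventually below `2^N` (private helper). [folklore] -/
private theorem exists_le_and_mul_add_lt_two_pow (a b n₁ : ℕ) : ∃ N : ℕ, n₁ ≤ N ∧ a * N + b < 2 ^ N := by
  set c := a + b + n₁ + 1 with hc
  have hc1 : 1 ≤ c := by omega
  have key : ∀ d : ℕ, 1 ≤ d → 3 * (d * d) < 4 ^ d := by
    intro d hd
    induction d with
    | zero => omega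
    | succ d ih =>
      rcases Nat.eq_zero_or_pos d with rfl | hdpos
      · norm_num
      · have ih' := ih hdpos
        have h4 : 4 ^ (d + 1) = 4 ^ d * 4 := pow_succ 4 d
        rw [h4]
        nlinarith [ih']
  refine ⟨2 * c, by omega, ?_⟩
  have h1 : a * (2 * c) + b ≤ 3 * (c * c) := by nlinarith
  calc a * (2 * c) + b ≤ 3 * (c * c) := h1
    _ < 4 ^ c := key c hc1
    _ = 2 ^ (2 * c) := by rw [pow_mul]; norm_num

/-! ## §3 The operator `conj_γ − 1` on the `p`-torsion unramified classes -/

section Tower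

variable {K : Type} [Field K] [NumberField K] {p : ℕ} [Fact p.Prime] (κ : ZpExtension K p)
variable {M : Type} [AddCommGroup M] [DistribMulAction (absoluteGaloisGroup K) M] [TopologicalSpace M]
  [DiscreteTopology M]

omit [NumberField K] in
/-- `conj_{σ^N} = (conj_σ)^N` on `H¹(H, M)` (`conjH1` is a left action). [cite: SerreLocalFields1979, VII.§5 Prop. 3] -/
theorem conjH1_pow_eq_pow_apply (H : Subgroup (absoluteGaloisGroup K)) [H.Normal]
    (σ : absoluteGaloisGroup K) (Φ : AddMonoid.End (subgroupH1 H M)) (hΦ : ∀ c, Φ c = conjH1 H M σ c)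
    (N : ℕ) (c : subgroupH1 H M) :
    conjH1 H M (σ ^ N) c = (Φ ^ N) c := by
  induction N generalizing c with
  | zero => rw [pow_zero, pow_zero, conjH1_one_holds, AddMonoidHom.id_apply, AddMonoid.End.coe_one, id]
  | succ N ih =>
    rw [pow_succ', conjH1_mul_holds H M σ (σ ^ N), AddMonoidHom.comp_apply, ih, pow_succ',
      AddMonoid.End.coe_mul, Function.comp_apply, hΦ]

/-- `S = unramifiedOutside H M 1 ∅` is stable under every `conj_σ`. [cite: GreenbergVatsal2000, §2 p. 16] -/
theorem conjH1_mem_unramifiedOutside (H : Subgroup (absoluteGaloisGroup K)) [H.Normal]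
    (σ : absoluteGaloisGroup K) {c : subgroupH1 H M}
    (hc : c ∈ unramifiedOutside H M 1 (∅ : Set (HeightOneSpectrum (𝓞 K)))) :
    conjH1 H M σ c ∈ unramifiedOutside H M 1 (∅ : Set (HeightOneSpectrum (𝓞 K))) := by
  rw [mem_unramifiedOutside_iff] at hc ⊢
  intro v hv hv1 τ
  rw [← AddMonoidHom.comp_apply, ← conjH1_mul_holds H M τ σ]
  exact hc v hv hv1 (τ * σ)

/-- **The discharge, explicit form.** `K` a number field, `p` odd or `K` totally complex, `κ` a `ℤ_p`-extension with
`ClassicalMuVanishes κ`, `M` a finite trivial `Γ_K`-module of order `p^k`: the subgroup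
`unramifiedOutside (ker κ) M 1 ∅ ⊆ H¹(ker κ, M)` (classes all of whose conjugates are unramified at every finite
place) is FINITE. [cite: Lang1990, Ch. 5 §1 Thm. 1.2 (iii), §4 pp. 137–143] [cite: Washington1997, §13.3 Prop. 13.23]
[cite: RaySujatha2021, §1 eq. (1.1)] -/
theorem finite_unramifiedOutside_of_classicalMuVanishes (hp : p ≠ 2 ∨ NumberField.IsTotallyComplex K)
    (hμ : ClassicalMuVanishes κ) [Finite M]
    (htriv : ∀ (σ : absoluteGaloisGroup K) (m : M), σ • m = m) (hcard : ∃ k : ℕ, Nat.card M = p ^ k) :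
    ((unramifiedOutside κ.kerSubgroup M 1 (∅ : Set (HeightOneSpectrum (𝓞 K))) :
      AddSubgroup (subgroupH1 κ.kerSubgroup M)) : Set (subgroupH1 κ.kerSubgroup M)).Finite := by
  have hpr : p.Prime := Fact.out
  obtain ⟨k, hk⟩ := hcard
  have hpM : ∀ m : M, p ^ k • m = 0 := fun m => by rw [← hk]; exact card_nsmul_eq_zero'
  obtain ⟨n₀, hn₀⟩ := exists_totallyRamifiedFrom κ
  obtain ⟨γ, hγ⟩ := κ.surjective (Multiplicative.ofAdd 1)
  have hγ' : κ.IsTopGenerator γ := hγ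
  obtain ⟨l, ν, n₁, hgrowth⟩ := hμ
  set H := κ.kerSubgroup with hH
  set S : AddSubgroup (subgroupH1 H M) :=
    unramifiedOutside H M 1 (∅ : Set (HeightOneSpectrum (𝓞 K))) with hSdef
  -- UPPER BOUND (part I): the classes of `S` fixed by `γ^{p^N}` form a finite set of bounded size
  have hupper : ∀ N : ℕ, n₀ ≤ N →
      {c : subgroupH1 H M | c ∈ S ∧ conjH1 H M (γ ^ p ^ N) c = c}.Finite ∧
        Nat.card {c : subgroupH1 H M | c ∈ S ∧ conjH1 H M (γ ^ p ^ N) c = c} ≤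
          Nat.card M ^ classNumberPExp κ (N + k) := by
    intro N hN
    have hbd : ∀ F : Finset (subgroupH1 H M),
        (↑F ⊆ {c : subgroupH1 H M | c ∈ S ∧ conjH1 H M (γ ^ p ^ N) c = c}) →
          F.card ≤ Nat.card M ^ classNumberPExp κ (N + k) := fun F hF =>
      finsetCard_le_pow_classNumberPExp κ hp htriv hpM hn₀ hγ' hN F (fun c hc => hF hc)
    have hfin : {c : subgroupH1 H M | c ∈ S ∧ conjH1 H M (γ ^ p ^ N) c = c}.Finite := by
      by_contra hinf
      obtain ⟨F, hFsub, hFcard⟩ := Set.Infinite.exists_subset_card_eq hinf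
        (Nat.card M ^ classNumberPExp κ (N + k) + 1)
      have := hbd F hFsub
      omega
    refine ⟨hfin, ?_⟩
    rw [Nat.card_coe_set_eq, Set.ncard_eq_toFinset_card _ hfin]
    exact hbd _ (by simp)
  -- reduction to the `p`-torsion classes
  set Sp : AddSubgroup (subgroupH1 H M) :=
    S ⊓ (DistribSMul.toAddMonoidHom (subgroupH1 H M) p).ker with hSpdef
  have hmemSp : ∀ c : subgroupH1 H M, c ∈ Sp ↔ c ∈ S ∧ p • c = 0 := fun c => by
    rw [hSpdef, AddSubgroup.mem_inf, AddMonoidHom.mem_ker, DistribSMul.toAddMonoidHom_apply]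
  suffices hSp : (Sp : Set (subgroupH1 H M)).Finite by
    refine finite_of_nsmul_finite S p (k := k) (fun c _ => ?_) ?_
    · exact FineSelmerRestrictionDescent.nsmul_subgroupH1_eq_zero H hpM c
    · refine hSp.subset fun c hc => ?_
      exact (hmemSp c).2 hc
  -- the operator `T = conj_γ − 1` in the ring `AddMonoid.End (H¹(H, M))`
  set Φ : AddMonoid.End (subgroupH1 H M) := conjH1 H M γ with hΦ
  set T : AddMonoid.End (subgroupH1 H M) := Φ - 1 with hT
  have hTapply : ∀ c, T c = conjH1 H M γ c - c := fun c => rfl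
  have hTmem : ∀ c ∈ Sp, T c ∈ Sp := by
    intro c hc
    rw [hmemSp] at hc ⊢
    refine ⟨?_, ?_⟩
    · rw [hTapply]
      exact S.sub_mem (conjH1_mem_unramifiedOutside H γ hc.1) hc.1
    · rw [hTapply, smul_sub, hc.2, ← map_nsmul, hc.2, map_zero, sub_zero]
  have hTsucc : ∀ (j : ℕ) (c : subgroupH1 H M), (T ^ (j + 1)) c = T ((T ^ j) c) := fun j c => by
    rw [pow_succ', AddMonoid.End.coe_mul, Function.comp_apply]
  have hTsucc' : ∀ (j : ℕ) (c : subgroupH1 H M), (T ^ (j + 1)) c = (T ^ j) (T c) := fun j c => by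
    rw [pow_succ, AddMonoid.End.coe_mul, Function.comp_apply]
  -- `T^{p^N} = conj_{γ^{p^N}} − 1` on `Sp`
  have hTpow : ∀ (N : ℕ) (c : subgroupH1 H M), c ∈ Sp →
      (T ^ p ^ N) c = conjH1 H M (γ ^ p ^ N) c - c := by
    intro N c hc
    have hc' : (p : ℤ) • c = 0 := by rw [natCast_zsmul]; exact ((hmemSp c).1 hc).2
    rw [hT, sub_one_pow_prime_pow_apply_of_torsion p Φ N hc', conjH1_pow_eq_pow_apply H γ Φ (fun _ => rfl)]
  -- the kernel chain `Kc j = Sp ∩ ker T^j`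
  let Kc : ℕ → AddSubgroup (subgroupH1 H M) := fun j =>
    { carrier := {c | c ∈ Sp ∧ (T ^ j) c = 0}
      add_mem' := fun {a b} ha hb => ⟨Sp.add_mem ha.1 hb.1, by rw [map_add, ha.2, hb.2, add_zero]⟩
      zero_mem' := ⟨Sp.zero_mem, map_zero _⟩
      neg_mem' := fun {a} ha => ⟨Sp.neg_mem ha.1, by rw [map_neg, ha.2, neg_zero]⟩ }
  have hmemKc : ∀ j c, c ∈ Kc j ↔ c ∈ Sp ∧ (T ^ j) c = 0 := fun j c => Iff.rfl
  have hmono : ∀ j, Kc j ≤ Kc (j + 1) := by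
    intro j c hc
    rw [hmemKc] at hc ⊢
    refine ⟨hc.1, ?_⟩
    rw [hTsucc, hc.2, map_zero]
  have hstab : ∀ j, Kc j = Kc (j + 1) → Kc (j + 1) = Kc (j + 2) := by
    intro j heq
    refine le_antisymm (hmono (j + 1)) fun c hc => ?_
    rw [hmemKc] at hc
    have hTc : T c ∈ Kc (j + 1) := by
      rw [hmemKc]
      refine ⟨hTmem c hc.1, ?_⟩
      rw [← hTsucc']; exact hc.2
    rw [← heq, hmemKc] at hTc
    rw [hmemKc]
    refine ⟨hc.1, ?_⟩
    rw [hTsucc']; exact hTc.2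
  -- `Kc (p^N)` sits inside the finite set of the upper bound
  have hKcsub : ∀ N, (Kc (p ^ N) : Set (subgroupH1 H M)) ⊆
      {c : subgroupH1 H M | c ∈ S ∧ conjH1 H M (γ ^ p ^ N) c = c} := by
    intro N c hc
    rw [SetLike.mem_coe, hmemKc] at hc
    refine ⟨((hmemSp c).1 hc.1).1, ?_⟩
    have h := hTpow N c hc.1
    rw [hc.2] at h
    exact (sub_eq_zero.1 h.symm).symm ▸ rfl
  have hfinKc : ∀ j, (Kc j : Set (subgroupH1 H M)).Finite := by
    intro j
    set N := max j n₀ with hN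
    have hjN : j ≤ p ^ N := (le_max_left j n₀).trans (Nat.lt_pow_self hpr.one_lt).le
    have hmono' : Monotone Kc := monotone_nat_of_le_succ hmono
    exact ((hupper N (le_max_right j n₀)).1.subset (hKcsub N)).subset (hmono' hjN)
  -- exhaustion: every class of `Sp` is killed by some `T^{p^N}`
  have hexh : ∀ c ∈ (Sp : Set (subgroupH1 H M)), ∃ j, c ∈ Kc j := by
    intro c hc
    have hstab' : ∀ m : M,
        IsOpen (MulAction.stabilizer (absoluteGaloisGroup K) m : Set (absoluteGaloisGroup K)) := by
      intro m
      have : (MulAction.stabilizer (absoluteGaloisGroup K) m : Set (absoluteGaloisGroup K)) = Set.univ :=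
        Set.eq_univ_of_forall fun σ => htriv σ m
      rw [this]; exact isOpen_univ
    obtain ⟨N, hN⟩ := exists_conjH1_pow_prime_pow_eq κ M hstab' hγ' c
    refine ⟨p ^ N, ?_⟩
    rw [hmemKc]
    refine ⟨hc, ?_⟩
    rw [hTpow N c hc, hN, sub_self]
  -- LOWER BOUND versus UPPER BOUND along the growth form
  by_contra hinf
  have hlow : ∀ j, 2 ^ j ≤ Nat.card (Kc j) := two_pow_le_card_of_chain Kc hmono hstab hfinKc hinf hexh
  obtain ⟨N, hN, hlt⟩ :=
    exists_le_and_mul_add_lt_two_pow (p * k * l) (p * k * (l * k + ν.toNat)) (max n₀ n₁)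
  have hNn₀ : n₀ ≤ N := (le_max_left _ _).trans hN
  have hNn₁ : n₁ ≤ N + k := ((le_max_right _ _).trans hN).trans (Nat.le_add_right N k)
  -- `2^{p^N} ≤ #Kc(p^N) ≤ #M ^ e_{N+k}`
  have h1 : 2 ^ p ^ N ≤ Nat.card M ^ classNumberPExp κ (N + k) := by
    refine (hlow (p ^ N)).trans ?_
    haveI : Finite {c : subgroupH1 H M | c ∈ S ∧ conjH1 H M (γ ^ p ^ N) c = c} := (hupper N hNn₀).1.to_subtype
    exact (Nat.card_mono (Set.toFinite _) (hKcsub N)).trans (hupper N hNn₀).2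
  -- `e_{N+k} ≤ λ (N+k) + ν⁺`
  have h2 : classNumberPExp κ (N + k) ≤ l * (N + k) + ν.toNat := by
    have h := hgrowth (N + k) hNn₁
    have : (classNumberPExp κ (N + k) : ℤ) ≤ l * (N + k) + ν.toNat := by
      rw [h]; push_cast; linarith [Int.self_le_toNat ν]
    exact_mod_cast this
  -- `#M ^ e ≤ 2 ^ (p k e)`
  have h3 : Nat.card M ^ classNumberPExp κ (N + k) ≤ 2 ^ (p * k * (l * (N + k) + ν.toNat)) := by
    rw [hk, ← pow_mul]
    calc p ^ (k * classNumberPExp κ (N + k)) ≤ (2 ^ p) ^ (k * classNumberPExp κ (N + k)) :=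
          Nat.pow_le_pow_left (Nat.lt_two_pow_self).le _
      _ = 2 ^ (p * (k * classNumberPExp κ (N + k))) := by rw [← pow_mul]
      _ ≤ 2 ^ (p * k * (l * (N + k) + ν.toNat)) := by
          apply Nat.pow_le_pow_right (by norm_num)
          rw [mul_assoc]
          exact Nat.mul_le_mul_left p (Nat.mul_le_mul_left k h2)
  have h4 : p ^ N ≤ p * k * (l * (N + k) + ν.toNat) :=
    (Nat.pow_le_pow_iff_right (by norm_num : 1 < 2)).1 (h1.trans h3)
  have h5 : 2 ^ N ≤ p ^ N := Nat.pow_le_pow_left hpr.two_le N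
  have h6 : p * k * (l * (N + k) + ν.toNat) = p * k * l * N + p * k * (l * k + ν.toNat) := by ring
  omega

end Tower

/-! ## §4 The named fact -/

/-- **DISCHARGE of `IwasawaTheory.classicalMuVanishes_finite_unramifiedClasses`** (Iwasawa's `μ = 0` in character
form: growth-form `μ = 0` for a `ℤ_p`-extension of a number field, `p` odd or `K` totally complex, ⟹ finitely many
classes of `H¹(Gal(K̄/K_∞), M)` unramified at every finite place together with all their conjugates, for every finite
`p`-primary trivial `Γ_K`-module `M`).  Proved by the finite-layer count of part I and the kernel chain of the locally
nilpotent operator `conj_γ − 1` on the `p`-torsion classes (this file); no structure theory, no `X_nr`.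
[cite: Lang1990, Ch. 5 §1 Thm. 1.2 (i)(iii), §3 Thm. 3.1, §4 pp. 137–143] [cite: RaySujatha2021, §1 eq. (1.1)]
[cite: Washington1997, §13.3] -/
theorem classicalMuVanishes_finite_unramifiedClasses_holds : classicalMuVanishes_finite_unramifiedClasses := by
  intro K _ _ p _ κ hodd hμ M _ _ _ _ _ hcard htriv
  have hpr : p.Prime := Fact.out
  have hp : p ≠ 2 ∨ NumberField.IsTotallyComplex K := by
    rcases hodd with h | h
    · exact Or.inl (by rintro rfl; exact (Nat.not_odd_iff_even.2 even_two) h)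
    · exact Or.inr h
  have h := finite_unramifiedOutside_of_classicalMuVanishes κ hp hμ htriv hcard
  rw [coe_unramifiedOutside_one_empty_eq] at h
  exact h

end Literature.NumberTheory.IwasawaTheory.ClassicalMuVanishesUnramifiedClasses

end

/-! ## `_holds` alias under the fact's exact fully-qualified name (appended 2026-08-29, flt-inv gen 69)

The discharge theorem above is declared one namespace DEEPER than the named fact
(`…IwasawaTheory.ClassicalMuVanishesUnramifiedClasses.classicalMuVanishes_finite_unramifiedClasses_holds` vs the
def `…IwasawaTheory.classicalMuVanishes_finite_unramifiedClasses`), so the tree's exact-name convention `X_holds`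
next to `X` was not met and the ledger's debt table still listed the fact unproved (`ledger fact claim` GRANTED
«status unproved», 2026-08-29T05:13Z).  D-0026 bookkeeping: the proof term is the existing theorem of this file;
no statement, definition or attribute is edited; no new named fact. -/

namespace Literature.NumberTheory.IwasawaTheory

/-- **`IwasawaTheory.classicalMuVanishes_finite_unramifiedClasses` holds** (Iwasawa's `μ = 0` in character
form) — the exact-name `_holds` alias of
`ClassicalMuVanishesUnramifiedClasses.classicalMuVanishes_finite_unramifiedClasses_holds`.
[cite: Lang1990, Ch. 5 §1 Thm. 1.2 (i)(iii), §3 Thm. 3.1, §4 pp. 137–143] [cite: RaySujatha2021, §1 eq. (1.1)]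
[cite: Washington1997, §13.3]
(`protected`, 2026-08-29: importers that `open` BOTH `…IwasawaTheory` and `…IwasawaTheory.ClassicalMuVanishesUnramifiedClasses`
— e.g. `Summits/BirchSwinnertonDyer/…/TwoAdicConverseOrdLambdaHalfAtTwoGreenbergGL1OfFW.lean` — otherwise see the bare name twice
(«Ambiguous term», fullbuild 2026-08-29T05:22Z); the fully-qualified name, which is what the debt table keys on, is unchanged.) -/
protected theorem classicalMuVanishes_finite_unramifiedClasses_holds :
    _root_.Literature.NumberTheory.IwasawaTheory.classicalMuVanishes_finite_unramifiedClasses :=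
  ClassicalMuVanishesUnramifiedClasses.classicalMuVanishes_finite_unramifiedClasses_holds

end Literature.NumberTheory.IwasawaTheory
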